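import Summits.ResolutionOfSingularities.ResolutionOfSingularities.Theses.PAlteration
import Summits.ResolutionOfSingularities.ResolutionOfSingularities.Theorems.PAlterationAssemblyLevels
import Literature.AlgebraicGeometry.Resolution.SncStrata
import Literature.AlgebraicGeometry.Resolution.SubschemeRegularStalks
import Literature.AlgebraicGeometry.Resolution.RegularLocalRingsQuotient
import Literature.AlgebraicGeometry.Resolution.ResolutionOfCurves
import Literature.AlgebraicGeometry.Motives.ReducedClosedSubschemeIso
import Literature.AlgebraicGeometry.Motives.VarietiesProperProofs
import Mathlib.AlgebraicGeometry.Morphisms.UniversallyInjective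
import Mathlib.AlgebraicGeometry.Morphisms.Finite
import Mathlib.AlgebraicGeometry.Morphisms.Proper
import HarnessLib

/-!
# Crux `Pialt` (stmt-ResolutionOfSingularities-0555): the EMBEDDED PARENT of the open atom
# `stub_hypersurfacePialt` — a purely inseparable embedded resolution of the pair `(ℙⁿ⁺¹, H)`
# yields the crux conclusion at the hypersurface `H` (glue, proved)

Line lead c3 (prover-line-stmt-ResolutionOfSingularities-0555-c3-0, 2026-08-17), `--supports`
stmt-ResolutionOfSingularities-0555. The crux strategist's census (`Cruxes/Pialt/STRATEGY-CENSUS.md`,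
(S5)) singles out, as the natural PARENT of the open atom `stub_hypersurfacePialt` of the exact
line `IndeterminacySplit` (`Pialt ⇔ FrobIndet ∧ HypersurfacePialt`), the EMBEDDED form of the
crux for pairs: de Jong's Theorem 4.1 with "alteration" replaced by "purely inseparable
alteration" and a REGULAR ambient variety — a statement that admits the classical inductions
(regular ambient space, boundary divisor, strict normal crossings). This file proves the glue
from that parent to the atom, so that a planner may re-line `stub_hypersurfacePialt` under it:

* `pialtConclusion_of_sncPreimage` — let `ι : H ↪ P` be a closed immersion of an integral scheme
  into a locally Noetherian scheme and `g : P' → P` proper with `P'` integral, surjective, finite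
  and universally injective over an open `U ⊆ P` MEETING `ι(H)`, such that `g⁻¹(ι(H))` is a strict
  normal crossings divisor of `P'` (de Jong 1996, 2.4). Then the conclusion of the crux holds at
  `H`: the point `η'` of `P'` over the generic point of `ι(H)` is unique (injectivity over `U`),
  hence a maximal point of the divisor `g⁻¹(ι(H))`; its closure `H'`, with the reduced structure,
  is an irreducible COMPONENT of a strict normal crossings divisor, hence REGULAR (at `t ∈ H'` the
  germ of `H'` is a minimal prime over `(x₁ ⋯ x_r)` for a part `x` of a regular system of
  parameters, i.e. some `(xᵢ)` — `IsRsopPart.mem_minimalPrimes_span_prod_iff` — and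
  `𝒪_{P',t}/(xᵢ)` is regular, Matsumura 14.2); `H' → P' → P` factors through `ι` (reduced
  source, image inside `ι(H)`: Mathlib's `IsClosedImmersion.lift`), and the factorisation
  `h : H' → H` is proper, surjective (its image is closed and contains the generic point), and
  finite and universally injective over the dense open `ι⁻¹(U)` (cancellation against the closed
  immersion `ι|_U`).
* `hypersurfacePialt_of_piEmbeddedResolution` — the registered atom `stub_hypersurfacePialt`
  (binders verbatim) from its embedded parent at `(ℙⁿ⁺¹_k, H)`: a proper `g : P' → ℙⁿ⁺¹_k` with
  `P'` integral regular, surjective, finite and universally injective over an open meeting `H`,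
  and `g⁻¹(H)` a strict normal crossings divisor.

Helper of independent use: `ker_eq_vanishingIdeal_closure_of_isReduced` (the kernel of a
quasi-compact morphism from a REDUCED scheme is the vanishing ideal sheaf of the closure of its
image); universal injectivity cancels on the left by the landed `universallyInjective_of_comp`
(`Theorems/PAlterationAssemblyLevels.lean`).

## References

* A. J. de Jong, *Smoothness, semi-stability and alterations*, Publ. Math. IHÉS 83 (1996), 2.4,
  Thm. 4.1. [DeJong1996]
* H. Matsumura, *Commutative Ring Theory* (1987), Thm. 14.2. [Matsumura1987]
-/

set_option linter.dupNamespace false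

noncomputable section

open CategoryTheory CategoryTheory.Limits AlgebraicGeometry TopologicalSpace Topology Order
  IsLocalRing
open Scheme.IdealSheafData
open Literature.AlgebraicGeometry.Resolution

namespace Summit.ResolutionOfSingularities.ResolutionOfSingularities.Theorems.Pialt.EmbeddedGlue

universe u

/-! ## A helper (universal injectivity cancels on the left: `universallyInjective_of_comp`,
`Theorems/PAlterationAssemblyLevels.lean`) -/

/-- **The kernel of a quasi-compact morphism from a reduced scheme is the vanishing ideal sheaf
of the closure of its image** (a radical ideal sheaf is the vanishing ideal of its support,
Mathlib's `vanishingIdeal_support`, and the support of the kernel is the closure of the image,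
`Scheme.Hom.support_ker`). [cite: Hartshorne1977, II Example 3.2.6] -/
theorem ker_eq_vanishingIdeal_closure_of_isReduced {X Y : Scheme.{u}} (f : X ⟶ Y)
    [QuasiCompact f] [IsReduced X] :
    f.ker = vanishingIdeal ⟨closure (Set.range f.base), isClosed_closure⟩ := by
  have hrad : f.ker.radical = f.ker := by
    refine le_antisymm ?_ (Scheme.IdealSheafData.le_radical (I := f.ker))
    intro U
    rw [Scheme.IdealSheafData.radical_ideal, Scheme.Hom.ker_apply]
    intro x hx
    obtain ⟨n, hn⟩ := hx
    rw [RingHom.mem_ker] at hn ⊢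
    rw [map_pow] at hn
    exact IsReduced.eq_zero _ ⟨n, hn⟩
  have h1 : vanishingIdeal f.ker.support = f.ker := by
    rw [Scheme.IdealSheafData.vanishingIdeal_support, hrad]
  rw [← h1]
  congr 1
  exact Closeds.ext f.support_ker

/-! ## The glue: an embedded purely inseparable resolution of `(P, H)` gives the crux at `H` -/

/-- **Embedded parent ⇒ the crux conclusion at `H`.** Let `ι : H ↪ P` be a closed immersion of
an integral scheme into a locally Noetherian scheme, and `g : P' → P` proper with `P'` integral,
`g` surjective, finite and universally injective over an open `U ⊆ P` meeting `ι(H)`, and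
`g⁻¹(ι(H))` a strict normal crossings divisor of `P'` (de Jong 1996, 2.4). Then there is a proper
surjective `h : H' → H` with `H'` integral and REGULAR, finite and universally injective over the
dense open `ι⁻¹(U)` — `H'` being the closure of the unique point of `P'` over the generic point
of `ι(H)`, an irreducible component of the divisor `g⁻¹(ι(H))`, with its reduced structure.
[cite: DeJong1996, 2.4, p. 55] -/
theorem pialtConclusion_of_sncPreimage {P H P' : Scheme.{u}} [IsLocallyNoetherian P]
    (ι : H ⟶ P) [IsClosedImmersion ι] [IsIntegral H] (g : P' ⟶ P) [IsProper g] [IsIntegral P']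
    (hsurj : Function.Surjective g.base) (U : P.Opens)
    (hU : ((U : Set P) ∩ Set.range ι.base).Nonempty) [IsFinite (g ∣_ U)]
    [UniversallyInjective (g ∣_ U)]
    (hsnc : IsStrictNormalCrossingsDivisor P' (g.base ⁻¹' Set.range ι.base)) :
    ∃ (H' : Scheme.{u}) (h : H' ⟶ H), IsProper h ∧ IsIntegral H' ∧ Scheme.IsRegular H' ∧
      Function.Surjective h.base ∧ ∃ V : H.Opens, Dense (V : Set H) ∧ IsFinite (h ∣_ V) ∧
        UniversallyInjective (h ∣_ V) := by
  classical
  haveI : IsLocallyNoetherian P' := LocallyOfFiniteType.isLocallyNoetherian g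
  have hZc : IsClosed (Set.range ι.base) := ι.isClosedEmbedding.isClosed_range
  -- the generic point `η` of `ι(H)`
  have hZη : Set.range ι.base = closure {ι.base (genericPoint H)} := by
    apply le_antisymm
    · rintro _ ⟨x, rfl⟩
      have hx : x ∈ closure ({genericPoint H} : Set H) :=
        specializes_iff_mem_closure.mp (genericPoint_specializes x)
      have := image_closure_subset_closure_image ι.continuous (Set.mem_image_of_mem ι.base hx)
      simpa only [Set.image_singleton] using this
    · exact closure_minimal (Set.singleton_subset_iff.mpr ⟨genericPoint H, rfl⟩) hZc
  have hηU : ι.base (genericPoint H) ∈ U := by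
    by_contra hcon
    obtain ⟨z, hzU, hzZ⟩ := hU
    have hsub : Set.range ι.base ⊆ (U : Set P)ᶜ := by
      rw [hZη]
      exact closure_minimal (Set.singleton_subset_iff.mpr hcon) U.isOpen.isClosed_compl
    exact hsub hzZ hzU
  -- the unique point `η'` of `P'` over `η`; it is a maximal point of `D = g⁻¹(ι(H))`
  obtain ⟨η', hη'⟩ := hsurj (ι.base (genericPoint H))
  have hDc : IsClosed (g.base ⁻¹' Set.range ι.base) := hZc.preimage g.continuous
  have hη'D : η' ∈ g.base ⁻¹' Set.range ι.base := by
    show g.base η' ∈ Set.range ι.base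
    rw [hη']
    exact ⟨genericPoint H, rfl⟩
  have hmax : η' ∈ maxPoints (g.base ⁻¹' Set.range ι.base) := by
    refine ⟨hη'D, fun x hxD hx => ?_⟩
    have h1 : g.base x ⤳ ι.base (genericPoint H) := hη' ▸ hx.map g.continuous
    have h2 : ι.base (genericPoint H) ⤳ g.base x := by
      rw [specializes_iff_mem_closure, ← hZη]
      exact hxD
    have hgx : g.base x = ι.base (genericPoint H) := (h1.antisymm h2).eq
    have hxU : x ∈ g ⁻¹ᵁ U := by show g.base x ∈ U; rw [hgx]; exact hηU
    have hη'U : η' ∈ g ⁻¹ᵁ U := by show g.base η' ∈ U; rw [hη']; exact hηU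
    have key : (⟨x, hxU⟩ : (g ⁻¹ᵁ U : P'.Opens)) = ⟨η', hη'U⟩ := by
      apply (g ∣_ U).injective
      apply Subtype.ext
      rw [morphismRestrict_base_coe, morphismRestrict_base_coe]
      change g.base x = g.base η'
      rw [hgx, hη']
    exact congrArg Subtype.val key
  -- `H'`: the reduced closed subscheme of `P'` on the closure of `η'`
  let C : P'.IdealSheafData := vanishingIdeal ⟨closure {η'}, isClosed_closure⟩
  have hCsupp : (C.support : Set P') = closure {η'} :=
    Scheme.IdealSheafData.coe_support_vanishingIdeal _
  have hclD : closure {η'} ⊆ g.base ⁻¹' Set.range ι.base :=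
    closure_minimal (Set.singleton_subset_iff.mpr hη'D) hDc
  haveI hint : IsIntegral C.subscheme :=
    isIntegral_subscheme_vanishingIdeal _ isIrreducible_singleton.closure
  -- `H'` is regular: a component of a strict normal crossings divisor
  have hreg : Scheme.IsRegular C.subscheme := by
    refine Scheme.isRegular_subscheme_of_forall C fun t ht => ?_
    have ht' : t ∈ closure ({η'} : Set P') := by rw [← hCsupp]; exact ht
    have hsp : η' ⤳ t := specializes_iff_mem_closure.mpr ht'
    have htD : t ∈ g.base ⁻¹' Set.range ι.base := hclD ht'
    obtain ⟨hregt, r, e, x, y, hr, hdim, hspan, hId⟩ :=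
      ((isStrictNormalCrossingsDivisor_iff_stalkIdeal P' _).mp hsnc).2 t htD
    haveI := hregt
    have hz : IsRsopPart x := ⟨hregt, e, y, hdim, hspan⟩
    have hDcl : (⟨closure (g.base ⁻¹' Set.range ι.base), isClosed_closure⟩ : Closeds P') =
        ⟨g.base ⁻¹' Set.range ι.base, hDc⟩ := Closeds.ext hDc.closure_eq
    rw [hDcl] at hId
    have hmin := primeOfSpecializes_mem_minimalPrimes_of_mem_maxPoints
      (Z := ⟨g.base ⁻¹' Set.range ι.base, hDc⟩) hmax hsp
    rw [hId] at hmin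
    obtain ⟨i, hi⟩ := (hz.mem_minimalPrimes_span_prod_iff _).mp hmin
    have hC : stalkIdeal C t = Ideal.span {x i} := by
      rw [← hi]
      exact stalkIdeal_vanishingIdeal_closure hsp
    rw [hC]
    have hxi : x i ∈ maximalIdeal (P'.presheaf.stalk t) :=
      hspan ▸ Ideal.subset_span (Or.inl ⟨i, rfl⟩)
    exact (IsRegularLocalRing.quotient_span_singleton hxi (hz.not_mem_sq i)).1
  -- `H' → P' → P` factors through `ι`
  have hrange : Set.range (C.subschemeι ≫ g).base ⊆ Set.range ι.base := by
    rintro _ ⟨t, rfl⟩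
    show g.base (C.subschemeι.base t) ∈ Set.range ι.base
    have ht : C.subschemeι.base t ∈ closure ({η'} : Set P') := by
      rw [← hCsupp, ← Scheme.IdealSheafData.range_subschemeι]
      exact ⟨t, rfl⟩
    exact hclD ht
  have hker : ι.ker ≤ (C.subschemeι ≫ g).ker := by
    rw [Literature.AlgebraicGeometry.Motives.ker_eq_vanishingIdeal_of_isReduced ι,
      ker_eq_vanishingIdeal_closure_of_isReduced (C.subschemeι ≫ g)]
    exact Scheme.IdealSheafData.vanishingIdeal_antimono (closure_minimal hrange hZc)
  obtain ⟨h, hh⟩ : ∃ h : C.subscheme ⟶ H, h ≫ ι = C.subschemeι ≫ g :=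
    ⟨IsClosedImmersion.lift ι _ hker, IsClosedImmersion.lift_fac _ _ _⟩
  refine ⟨C.subscheme, h, ?_, hint, hreg, ?_, ι ⁻¹ᵁ U, ?_, ?_, ?_⟩
  · -- proper: `h ≫ ι` is proper and `ι` is separated
    haveI : IsProper (h ≫ ι) := by rw [hh]; infer_instance
    exact IsProper.of_comp h ι
  · -- surjective: the image of `h ≫ ι` is closed and contains the generic point of `ι(H)`
    intro z
    haveI : IsProper (h ≫ ι) := by rw [hh]; infer_instance
    have hcl : IsClosed (Set.range (h ≫ ι).base) := (h ≫ ι).isClosedMap.isClosed_range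
    have hη'C : η' ∈ C.support := by
      rw [← SetLike.mem_coe, hCsupp]
      exact subset_closure rfl
    have hηr : ι.base (genericPoint H) ∈ Set.range (h ≫ ι).base := by
      refine ⟨⟨η', hη'C⟩, ?_⟩
      rw [hh]
      show g.base (C.subschemeι.base ⟨η', hη'C⟩) = _
      rw [Scheme.IdealSheafData.subschemeι_apply]
      exact hη'
    have hZr : Set.range ι.base ⊆ Set.range (h ≫ ι).base := by
      rw [hZη]
      exact closure_minimal (Set.singleton_subset_iff.mpr hηr) hcl
    obtain ⟨t, ht⟩ := hZr ⟨z, rfl⟩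
    refine ⟨t, ι.injective ?_⟩
    rwa [Scheme.Hom.comp_apply] at ht
  · -- `ι⁻¹(U)` is a dense open of `H`: it contains the generic point
    exact (ι ⁻¹ᵁ U).isOpen.dense ⟨genericPoint H, hηU⟩
  · -- finite over `ι⁻¹(U)`: `(h|) ≫ (ι|_U) = (H' ↪ P' → P)|_U` is finite, `ι|_U` separated
    have i0' : IsFinite (C.subschemeι ∣_ g ⁻¹ᵁ U ≫ g ∣_ U) := inferInstance
    have i0 : IsFinite ((C.subschemeι ≫ g) ∣_ U) := by
      rw [morphismRestrict_comp]; exact i0'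
    have i1 : IsFinite ((h ≫ ι) ∣_ U) := by rw [hh]; exact i0
    have i2 : IsFinite (h ∣_ ι ⁻¹ᵁ U ≫ ι ∣_ U) := by
      rw [← morphismRestrict_comp]; exact i1
    exact IsFinite.of_comp (h ∣_ ι ⁻¹ᵁ U) (ι ∣_ U)
  · -- universally injective over `ι⁻¹(U)`, by the same cancellation
    have i0' : UniversallyInjective (C.subschemeι ∣_ g ⁻¹ᵁ U ≫ g ∣_ U) :=
      MorphismProperty.comp_mem _ _ _
        (inferInstance : UniversallyInjective (C.subschemeι ∣_ g ⁻¹ᵁ U))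
        (inferInstance : UniversallyInjective (g ∣_ U))
    have i0 : UniversallyInjective ((C.subschemeι ≫ g) ∣_ U) := by
      rw [morphismRestrict_comp]; exact i0'
    have i1 : UniversallyInjective ((h ≫ ι) ∣_ U) := by rw [hh]; exact i0
    have i2 : UniversallyInjective (h ∣_ ι ⁻¹ᵁ U ≫ ι ∣_ U) := by
      rw [← morphismRestrict_comp]; exact i1
    exact Theorems.universallyInjective_of_comp (h ∣_ ι ⁻¹ᵁ U) (ι ∣_ U)

/-- **The registered atom `stub_hypersurfacePialt` from its EMBEDDED PARENT at `(ℙⁿ⁺¹_k, H)`**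
(binders of the atom verbatim): if the pair `(ℙⁿ⁺¹_k, H)` has a purely inseparable embedded
resolution — a proper `g : P' → ℙⁿ⁺¹_k` with `P'` integral and regular, `g` surjective, finite
and universally injective over an open meeting `H`, and `g⁻¹(H)` a strict normal crossings
divisor of `P'` (de Jong 1996, Thm. 4.1 with "alteration" replaced by "purely inseparable
alteration of the regular ambient space") — then `H` satisfies the conclusion of the crux `Pialt`.
Regularity of `P'` away from `g⁻¹(H)`, perfectness of `k`, the characteristic and the dimension
hypothesis are idle. [cite: DeJong1996, Thm. 4.1, p. 66] -/
theorem hypersurfacePialt_of_piEmbeddedResolution (p : ℕ) (_hp : p.Prime) (k : Type) [Field k]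
    [CharP k p] [PerfectField k] (n : ℕ) (H : Scheme.{0})
    (ι : H ⟶ (Literature.AlgebraicGeometry.Motives.projectiveSpace (n + 1) k).left)
    [IsClosedImmersion ι] [IsIntegral H] (_hdim : topologicalKrullDim H = (n : WithBot ℕ∞))
    (hE : ∃ (P' : Scheme.{0})
      (g : P' ⟶ (Literature.AlgebraicGeometry.Motives.projectiveSpace (n + 1) k).left),
      IsProper g ∧ IsIntegral P' ∧ Scheme.IsRegular P' ∧ Function.Surjective g.base ∧
      (∃ U : (Literature.AlgebraicGeometry.Motives.projectiveSpace (n + 1) k).left.Opens,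
        ((U : Set _) ∩ Set.range ι.base).Nonempty ∧ IsFinite (g ∣_ U) ∧
          UniversallyInjective (g ∣_ U)) ∧
      IsStrictNormalCrossingsDivisor P' (g.base ⁻¹' Set.range ι.base)) :
    ∃ (H' : Scheme.{0}) (g : H' ⟶ H), IsProper g ∧ IsIntegral H' ∧ Scheme.IsRegular H' ∧
      Function.Surjective g.base ∧ ∃ U : H.Opens, Dense (U : Set H) ∧ IsFinite (g ∣_ U) ∧
        UniversallyInjective (g ∣_ U) := by
  obtain ⟨P', g, hg, hP', -, hsurj, ⟨U, hU, hfin, hui⟩, hsnc⟩ := hE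
  haveI := hg; haveI := hP'; haveI := hfin; haveI := hui
  haveI : IsProper (Literature.AlgebraicGeometry.Motives.projectiveSpace (n + 1) k).hom :=
    Literature.AlgebraicGeometry.Motives.isProper_projectiveSpace (n + 1) k
  haveI : IsLocallyNoetherian
      (Literature.AlgebraicGeometry.Motives.projectiveSpace (n + 1) k).left :=
    LocallyOfFiniteType.isLocallyNoetherian
      (Literature.AlgebraicGeometry.Motives.projectiveSpace (n + 1) k).hom
  exact pialtConclusion_of_sncPreimage ι g hsurj U hU hsnc

end Summit.ResolutionOfSingularities.ResolutionOfSingularities.Theorems.Pialt.EmbeddedGlue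

end
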